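import Summits.SmoothPoincare4.SmoothPoincare4.Theorems.EntropyRungChangGurskyYangOfFourFacts
import Literature.Geometry.Riemannian.GurskyViaclovskyC1EstimateProofs
import HarnessLib

/-!
# Route EntropyRung · crux `ChangGurskyYang` — the crux modulo THREE one-fact leaves
# (the Gursky–Viaclovsky `C¹` estimate being a theorem of the tree)

Skeleton r11 of line `margerin-cone-hamilton-rails` (continuation lead c4, crux stmt-SmoothPoincare4-10834):
of the four one-fact leaves of r10 (`EntropyRungChangGurskyYangOfFourFacts.lean`, p121014) the a priori `C¹`
estimate `gurskyViaclovsky_gradientEstimate_weighted_four` is now PROVED in the tree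
(`gurskyViaclovsky_gradientEstimate_weighted_four_holds`, `GurskyViaclovskyC1EstimateProofs.lean`: the
maximum principle for `|∇u|²_g` in charts — `Lorentzian/CoordSigma2GradientEstimate.lean`, the cone algebra of
Gursky–Viaclovsky's Lemma 2 `Lorentzian/CoordSigma2GradientAlgebra.lean`, Glaeser's inequality
`Analysis/Calculus/GlaeserInequality.lean`). Feeding it in leaves THREE named facts between the tree and
Chang–Gursky–Yang's Theorem A: Hamilton's compactness theorem for Ricci flows (time-zero slice) and the
Gursky–Viaclovsky openness and closedness of the solvable set along the Weyl-weighted `σ₂` path; CGY Thm. 1.4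
(`changGurskyYang_theorem14_four`) becomes a consequence of the two remaining GV facts. No `sorry`, no definition.
-/

noncomputable section

-- every `Summit.SmoothPoincare4.SmoothPoincare4.…` name repeats the summit = sub-problem segment (D-0017 layout)
set_option linter.dupNamespace false

namespace Summit.SmoothPoincare4.SmoothPoincare4.Theorems.MargerinRails

open Literature.Geometry.Riemannian
open Summit.SmoothPoincare4.SmoothPoincare4.Theses.EntropyRung (ChangGurskyYang)

/-- **CGY 2003 Thm. 1.4 (`α = 1`, connected `Y > 0` form, the tree's named fact
`changGurskyYang_theorem14_four`) from the TWO remaining Gursky–Viaclovsky facts** — openness and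
closedness of the solvable set — the `C¹` and `C²` estimates being supplied by the tree theorems
`gurskyViaclovsky_gradientEstimate_weighted_four_holds` and `gurskyViaclovsky_hessianEstimate_weighted_four_holds`
(via `changGurskyYang_theorem14_four_of_threeGvFacts`, p121014).
[cite: ChangGurskyYang2003, Thm. 1.4] [cite: GurskyViaclovsky2003, Props. 2, 5, 6 and §5] -/
theorem changGurskyYang_theorem14_four_of_twoGvFacts :
    gurskyViaclovsky_pathOpen_weighted_four → gurskyViaclovsky_pathClosed_weighted_four →
    changGurskyYang_theorem14_four :=
  fun hO hC ↦ changGurskyYang_theorem14_four_of_threeGvFacts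
    gurskyViaclovsky_gradientEstimate_weighted_four_holds hO hC

/-- **The crux `EntropyRung.ChangGurskyYang` from its THREE remaining one-fact leaves**: Hamilton's 1995
compactness theorem (time-zero slice, Morgan–Tian volume form) and the Gursky–Viaclovsky openness and
closedness along the Weyl-weighted path — `ChangGurskyYang_of_fourFacts` (p121014) with the `C¹` estimate
discharged by `gurskyViaclovsky_gradientEstimate_weighted_four_holds`.
[cite: ChangGurskyYang2003, §2, p. 121] [cite: Hamilton1995Compactness, Thm. 1.2]
[cite: GurskyViaclovsky2003, Prop. 2 and §5] -/
theorem ChangGurskyYang_of_threeFacts :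
    hamilton_compactness_ricciFlow_slice_four →
    gurskyViaclovsky_pathOpen_weighted_four → gurskyViaclovsky_pathClosed_weighted_four → ChangGurskyYang :=
  fun hF hO hC ↦ ChangGurskyYang_of_fourFacts hF gurskyViaclovsky_gradientEstimate_weighted_four_holds hO hC

/-- The same for the item's second route decl `WeylBudget.ChangGurskyYang` (the same proposition).
[cite: ChangGurskyYang2003, Thm. A] -/
theorem ChangGurskyYang_weylBudget_of_threeFacts :
    hamilton_compactness_ricciFlow_slice_four →
    gurskyViaclovsky_pathOpen_weighted_four → gurskyViaclovsky_pathClosed_weighted_four →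
      Summit.SmoothPoincare4.SmoothPoincare4.Theses.WeylBudget.ChangGurskyYang :=
  ChangGurskyYang_of_threeFacts

/-- **The Literature named fact `changGurskyYang_sphere_four` (CGY 2003 Thm. A, simply connected
`scal > 0` case) from the same three facts**, for the fact's other consumers.
[cite: ChangGurskyYang2003, Thm. A and §2, p. 121] -/
theorem changGurskyYang_sphere_four_of_threeFacts :
    hamilton_compactness_ricciFlow_slice_four →
    gurskyViaclovsky_pathOpen_weighted_four → gurskyViaclovsky_pathClosed_weighted_four →
    changGurskyYang_sphere_four :=
  ChangGurskyYang_of_threeFacts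

end Summit.SmoothPoincare4.SmoothPoincare4.Theorems.MargerinRails

end
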